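import Mathlib
import HarnessLib
import Literature.Analysis.FluidPDE.TypeIAncientMildTimeAnalytic
import Literature.Analysis.FluidPDE.TypeIAncientMildRescale
import Literature.Analysis.FluidPDE.OseenMildUniqueness
import Literature.Analysis.FluidPDE.AxisymmetricEuler
import Summits.NavierStokesRegularity.NavierStokesRegularity.Theorems.ExtremiserTransienceTypeIAncientAxiallyPeriodicLiouville
import Summits.NavierStokesRegularity.NavierStokesRegularity.Theorems.SymmetryModuliCountSymmetricLiouvilleRotationCovariance
import Summits.NavierStokesRegularity.NavierStokesRegularity.Theorems.PoloidalWindowDoorPoloidalWindowRigidityWindow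

/-!
# Item `LrcModEntire` (stmt-NavierStokesRegularity-20428), cell (Q4), registry v9 child `stub_Q4line` — kernel piece E2 «PeriodicSlice» of LEAD g16's plan
# (memo `Cruxes/LrcModEntire/T2B-g16.md` §4 (A3) / §6(iii)): ONE slice with a spatial period kills a Type-I ancient mild profile

Seat ns-poloidal-K2-p2 g15 (hand under the LEAD of item 20428, ns-poloidal-K2-p3 g16; `--supports stmt-NavierStokesRegularity-20428 --as helper`).

* `translate_eq_of_slice_eq` — **one invariant slice propagates**: if a class-`C` profile `U` has ONE slice `U t₀`, `t₀ < 0`, invariant under the translation by a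
  vector `τ` (`U t₀ (x + τ) = U t₀ x`), then EVERY slice is (`U t (x + τ) = U t x` for all `t < 0`): the translate is a class profile with the same slice at `t₀`
  (`IsTypeIAncientMild.comp_add_right`), forward uniqueness of bounded Oseen-mild solutions identifies it with `U` on `(t₀, t₀/2)`
  (`Literature…oseenMild_bounded_unique`, [GIM]/KNSS), and real-analyticity in time (`IsTypeIAncientMild.analyticOnNhd_time`, Lemarié-Rieusset Thm 9.12)
  on the whole past — the pattern of `…TwistingTHFlatSlab.false_of_flatSlab` Steps F–G, for an arbitrary translation vector and slice time.
* `eq_zero_of_periodic_slice` — **(A3) for a PERIOD**: a class-`C` profile with one slice having a period `τ ≠ 0` (any direction) vanishes on the past: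
  conjugate by a linear isometry taking `τ/‖τ‖` to `e₂` (`reflection_sub`; the class is isometry-covariant, `…RotationCovariance.isTypeIAncientMild_conj_linearIsometryEquiv`)
  and apply the tree's KNSS axially-periodic Liouville theorem `…TypeIAncientAxiallyPeriodicLiouville.eq_zero_of_isTypeIAncientMild_of_isAxiallyPeriodic`.

WHAT THIS IS NOT: not a claim about Navier–Stokes regularity — a class-level Liouville brick for the PROVABLE child `stub_Q4line` of the (Q4) research cell
(bears_on LADDER-NS N0, item 20428 / crux 19708; `stub_Q4line`, `stub_Q4curved`, `stub_Q4sonic`, 20428/19708/27893 OPEN).  No summit statement is proved here.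
-/

noncomputable section

-- the summit and its single sub-problem share the name (CONVENTIONS §1), as in every Theorems file
set_option linter.dupNamespace false

namespace Summit.NavierStokesRegularity.NavierStokesRegularity.Theorems.PoloidalWindowDoorLrcModEntirePeriodicSlice

open Set Function Filter Topology Metric MeasureTheory
open scoped RealInnerProductSpace InnerProductSpace ContDiff
open Literature.Analysis Literature.Analysis.FluidPDE Literature.Analysis.UnboundedOperators
open Summit.NavierStokesRegularity.NavierStokesRegularity.Theorems

/-- **One translation-invariant slice propagates to every slice.**  See the module docstring. -/
theorem translate_eq_of_slice_eq {C : ℝ} {U : ℝ → EuclideanSpace ℝ (Fin 3) → EuclideanSpace ℝ (Fin 3)} (hU : IsTypeIAncientMild C U)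
    (τ : EuclideanSpace ℝ (Fin 3)) {t₀ : ℝ} (ht₀ : t₀ < 0) (hslice : ∀ x, U t₀ (x + τ) = U t₀ x) :
    ∀ t < 0, ∀ x, U t (x + τ) = U t x := by
  have hC : 0 ≤ C := hU.nonneg
  have hU' : IsTypeIAncientMild C (fun t x => U t (x + τ)) := hU.comp_add_right τ
  have hslice' : (fun x => U t₀ (x + τ)) = U t₀ := funext hslice
  -- Step F: forward uniqueness on `(t₀, t₀/2)`
  have hT : t₀ < t₀ / 2 := by linarith
  have hT0 : t₀ / 2 < 0 := by linarith
  set M : ℝ := C / Real.sqrt (-(t₀ / 2)) with hM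
  have hM0 : 0 ≤ M := by positivity
  have hbound : ∀ (w : ℝ → EuclideanSpace ℝ (Fin 3) → EuclideanSpace ℝ (Fin 3)), HasTypeITimeDecay C w →
      ∀ s ∈ Ioo t₀ (t₀ / 2), ∀ y, ‖w s y‖ ≤ M := by
    intro w hw s hs y
    have h1 := hw s (by linarith [hs.2]) y
    have hsq : Real.sqrt (-(t₀ / 2)) ≤ Real.sqrt (-s) := Real.sqrt_le_sqrt (by linarith [hs.2])
    have hpos : 0 < Real.sqrt (-(t₀ / 2)) := Real.sqrt_pos.2 (by linarith)
    exact h1.trans (div_le_div_of_nonneg_left hC hpos hsq)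
  have hsub : Ioo t₀ (t₀ / 2) ×ˢ (univ : Set (EuclideanSpace ℝ (Fin 3))) ⊆ Iio 0 ×ˢ univ :=
    prod_mono (fun s hs => by simp only [mem_Iio]; linarith [hs.2]) le_rfl
  have hmeas : MeasurableSet (Ioo t₀ (t₀ / 2) ×ˢ (univ : Set (EuclideanSpace ℝ (Fin 3)))) := measurableSet_Ioo.prod MeasurableSet.univ
  have hae := oseenMild_bounded_unique (ν := 1) (s := t₀) (T := t₀ / 2) (M := M) one_pos hM0
    (U := fun t x => heatExtension (U t₀) (t - t₀) x)
    ((hU.continuousOn_uncurry.mono hsub).aestronglyMeasurable hmeas) ((hU'.continuousOn_uncurry.mono hsub).aestronglyMeasurable hmeas)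
    (hbound U hU.hasTypeITimeDecay) (hbound _ hU'.hasTypeITimeDecay)
    (fun t ht => Eventually.of_forall fun x => hU.mild_eq_heatExtension ht.1 (by linarith [ht.2]) x)
    (fun t ht => Eventually.of_forall fun x => by
      have h1 := hU'.mild_eq_heatExtension ht.1 (by linarith [ht.2]) x
      simp only at h1
      rw [hslice'] at h1
      exact h1)
  have hfwd : ∀ t ∈ Ioo t₀ (t₀ / 2), ∀ x, U t (x + τ) = U t x := by
    intro t ht x
    have h1 : U t =ᵐ[volume] fun x => U t (x + τ) := hae t ht
    have hc1 : Continuous (U t) := hU.continuous_slice (by linarith [ht.2])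
    have hc2 : Continuous (fun x => U t (x + τ)) := hU'.continuous_slice (by linarith [ht.2])
    have h2 := (Continuous.ae_eq_iff_eq volume hc1 hc2).1 h1
    exact (congrFun h2 x).symm
  -- Step G: real-analyticity in time
  intro t ht x
  have han : AnalyticOnNhd ℝ (fun σ : ℝ => U σ (x + τ) - U σ x) (Iio 0) := (hU.analyticOnNhd_time (x + τ)).sub (hU.analyticOnNhd_time x)
  have hmid : (3 / 4 : ℝ) * t₀ ∈ Ioo t₀ (t₀ / 2) := ⟨by linarith, by linarith⟩
  have hev : (fun σ : ℝ => U σ (x + τ) - U σ x) =ᶠ[𝓝 ((3 / 4 : ℝ) * t₀)] 0 := by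
    filter_upwards [Ioo_mem_nhds hmid.1 hmid.2] with σ hσ
    simp [hfwd σ hσ x]
  have h0 := han.eqOn_zero_of_preconnected_of_eventuallyEq_zero isPreconnected_Iio (show (3 / 4 : ℝ) * t₀ ∈ Iio 0 by
    simp only [mem_Iio]; linarith) hev ht
  simpa [sub_eq_zero] using h0

/-- **(A3) for a PERIOD: one slice with a spatial period kills the profile.**  See the module docstring. -/
theorem eq_zero_of_periodic_slice {C : ℝ} {U : ℝ → EuclideanSpace ℝ (Fin 3) → EuclideanSpace ℝ (Fin 3)} (hU : IsTypeIAncientMild C U)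
    {τ : EuclideanSpace ℝ (Fin 3)} (hτ : τ ≠ 0) {t₀ : ℝ} (ht₀ : t₀ < 0) (hslice : ∀ x, U t₀ (x + τ) = U t₀ x) :
    ∀ t < 0, ∀ x, U t x = 0 := by
  have hall := translate_eq_of_slice_eq hU τ ht₀ hslice
  -- a linear isometry taking `τ` to `‖τ‖ e₂`
  set e₂ : EuclideanSpace ℝ (Fin 3) := EuclideanSpace.single 2 (1 : ℝ) with he₂
  set ℓ : ℝ := ‖τ‖ with hℓ
  have hℓ0 : 0 < ℓ := norm_pos_iff.2 hτ
  have hnorm : ‖τ‖ = ‖ℓ • e₂‖ := by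
    have h1 : ‖e₂‖ = 1 := by simp [he₂]
    rw [norm_smul, h1, mul_one, Real.norm_of_nonneg hℓ0.le]
  set L : EuclideanSpace ℝ (Fin 3) ≃ₗᵢ[ℝ] EuclideanSpace ℝ (Fin 3) := Submodule.reflection (ℝ ∙ (τ - ℓ • e₂))ᗮ with hLdef
  have hLτ : L τ = ℓ • e₂ := Submodule.reflection_sub hnorm
  -- the conjugated profile is a class profile, axially periodic with period `ℓ` at every time
  set W : ℝ → EuclideanSpace ℝ (Fin 3) → EuclideanSpace ℝ (Fin 3) := fun t x => L (U t (L.symm x)) with hW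
  have hWc : IsTypeIAncientMild C W :=
    SymmetryModuliCountSymmetricLiouville.isTypeIAncientMild_conj_linearIsometryEquiv hU L
  have hper : ∀ t < 0, IsAxiallyPeriodic ℓ (W t) := by
    intro t ht x
    show L (U t (L.symm (x + ℓ • EuclideanSpace.single 2 (1 : ℝ)))) = L (U t (L.symm x))
    have e : L.symm (x + ℓ • EuclideanSpace.single 2 (1 : ℝ)) = L.symm x + τ := by
      rw [map_add, ← he₂, ← hLτ, LinearIsometryEquiv.symm_apply_apply]
    rw [e, hall t ht]
  have hW0 := AxiallyPeriodicLiouville.eq_zero_of_isTypeIAncientMild_of_isAxiallyPeriodic hWc hℓ0 hper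
  intro t ht x
  have h := hW0 t ht (L x)
  have h' : L (U t x) = 0 := by simpa [hW] using h
  exact (LinearIsometryEquiv.map_eq_zero_iff L).1 h'

/-- **(A3) for a PERIOD, binder currency** (the four class clauses instead of `IsTypeIAncientMild`). -/
theorem eq_zero_of_periodic_slice_of_class {C : ℝ} {U : ℝ → EuclideanSpace ℝ (Fin 3) → EuclideanSpace ℝ (Fin 3)}
    (hrate : HasTypeITimeDecay C U) (hcont : ContinuousOn (uncurry U) (Iio (0 : ℝ) ×ˢ univ))
    (hmild : ∀ s t : ℝ, s < t → t < 0 → ∀ x, U t x = heatExtension (U s) (t - s) x - oseenDuhamel 1 s U U t x)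
    (hdiv : ∀ t < 0, VectorCalculus.IsDivFree (U t))
    {τ : EuclideanSpace ℝ (Fin 3)} (hτ : τ ≠ 0) {t₀ : ℝ} (ht₀ : t₀ < 0) (hslice : ∀ x, U t₀ (x + τ) = U t₀ x) :
    ∀ t < 0, ∀ x, U t x = 0 :=
  eq_zero_of_periodic_slice (PoloidalWindowDoorPoloidalWindowRigidityWindow.isTypeIAncientMild_of_class hrate hcont hmild hdiv) hτ ht₀ hslice

/-- **Horizontal translation symmetry of one slice kills the profile** (the LINE case of (A3) read as a period: invariance under ALL multiples `l • e` of a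
horizontal direction gives in particular the period `e`). -/
theorem eq_zero_of_translationInvariant_slice {C : ℝ} {U : ℝ → EuclideanSpace ℝ (Fin 3) → EuclideanSpace ℝ (Fin 3)} (hU : IsTypeIAncientMild C U)
    {e : EuclideanSpace ℝ (Fin 3)} (he : e ≠ 0) {t₀ : ℝ} (ht₀ : t₀ < 0) (hinv : ∀ (l : ℝ) (x : EuclideanSpace ℝ (Fin 3)), U t₀ (x + l • e) = U t₀ x) :
    ∀ t < 0, ∀ x, U t x = 0 :=
  eq_zero_of_periodic_slice hU he ht₀ fun x => by simpa using hinv 1 x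

end Summit.NavierStokesRegularity.NavierStokesRegularity.Theorems.PoloidalWindowDoorLrcModEntirePeriodicSlice

end
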